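import Literature.Analysis.FluidPDE.PassiveVectorTensorWeightedGalerkinIdentity
import HarnessLib

/-!
# Band-flux toolkit, step 1: Fourier coefficients of (band-limited carrier) × (L² field) are shifted sums

Analysis/FluidPDE proof-support file (everything proved; no definitions, no named facts).  First step of the
flux ↔ commutator identification for the weighted Galerkin identity (`PassiveVectorTensorWeightedGalerkinIdentity`):
the vector-valued SHIFT RULE `𝓕(e_y • g)(k) = ĝ(k − y)` and its finite linear combination
`𝓕((Σ_{y∈B} c_y e_y) • g)(k) = Σ_{y∈B} c_y • ĝ(k − y)` for an integrable `g : 𝕋^d → E` — so that the transport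
coefficients `𝓕(b_a w)(k)` of the flat class with a band-limited (trigonometric-polynomial) carrier component
`b_a = Σ_y β_{a,y} e_y` are the discrete convolutions `Σ_y β_{a,y} ŵ(k − y)` that `Fourier/LatticeTransportCommutator`
consumes (Boyd 2001, §4.5 Thm 19 (4.44): product ↔ convolution of coefficient sequences).

## Mathlib / tree search
Tree: scalar versions `Literature.Analysis.Fourier.mFourierCoeff_mFourier_mul`, `mFourierCoeff_trigPoly_mul` (`TorusGridAliasingTail`,
continuous `g`) and the vector shift rule `TorusLpOperatorFactsCommutatorProofs.mFourierCoeff_mFourier_smul` (private twin here to keep the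
import closure small); the finite-combination form for integrable `E`-valued `g` is new.

## References
* J. P. Boyd, *Chebyshev and Fourier Spectral Methods*, 2nd ed. (Dover 2001), §4.5 Theorem 19 (4.44). [`Boyd2001`]
-/

noncomputable section

open MeasureTheory Complex UnitAddTorus Finset

namespace Literature.Analysis.FluidPDE

namespace Torus

variable {d : Type*} [Fintype d] {E : Type*} [NormedAddCommGroup E] [NormedSpace ℂ E]

/-- Shift rule, vector-valued: `𝓕(e_y • g)(k) = ĝ(k − y)` (private twin of
`TorusLpOperatorFactsCommutatorProofs.mFourierCoeff_mFourier_smul`, not imported here). [folklore] -/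
private theorem mFourierCoeff_mFourier_smul' (g : UnitAddTorus d → E) (y k : d → ℤ) :
    mFourierCoeff (fun x => mFourier y x • g x) k = mFourierCoeff g (k - y) := by
  unfold mFourierCoeff
  congr 1
  funext t
  rw [smul_smul, ← mFourier_add]
  congr 2
  abel

/-- **Coefficients of (trigonometric polynomial) • g** for integrable `g`:
`𝓕((Σ_{y∈B} c_y e_y) • g)(k) = Σ_{y∈B} c_y • ĝ(k − y)`. [cite: Boyd2001, §4.5 Theorem 19 (4.44)] -/
theorem mFourierCoeff_trigPoly_smul {g : UnitAddTorus d → E} (hg : Integrable g volume) (B : Finset (d → ℤ))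
    (c : (d → ℤ) → ℂ) (k : d → ℤ) :
    mFourierCoeff (fun x => (∑ y ∈ B, c y * mFourier y x) • g x) k = ∑ y ∈ B, c y • mFourierCoeff g (k - y) := by
  classical
  induction B using Finset.induction_on with
  | empty =>
    simp only [Finset.sum_empty, zero_smul]
    unfold mFourierCoeff
    simp
  | insert a s ha ih =>
    rw [Finset.sum_insert ha, ← ih, ← mFourierCoeff_mFourier_smul']
    have esum : (fun x => (∑ y ∈ insert a s, c y * mFourier y x) • g x) =
        fun x => (c a * mFourier a x + ∑ y ∈ s, c y * mFourier y x) • g x := by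
      funext x; rw [Finset.sum_insert ha]
    rw [esum]
    -- bounded continuous multipliers keep integrability
    have hbdd : ∀ (φ : UnitAddTorus d → ℂ), Continuous φ → Integrable (fun x => φ x • g x) volume := by
      intro φ hφ
      obtain ⟨C, hC⟩ := (isCompact_univ.image hφ).isBounded.exists_norm_le
      refine Integrable.mono' (hg.norm.const_mul C) (hφ.aestronglyMeasurable.smul hg.1) (ae_of_all _ fun x => ?_)
      rw [norm_smul]
      exact mul_le_mul_of_nonneg_right (hC _ ⟨x, Set.mem_univ _, rfl⟩) (norm_nonneg _)
    have h1 : Integrable (fun x => mFourier a x • g x) volume := hbdd _ (mFourier a).continuous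
    have h2 : Integrable (fun x => (∑ y ∈ s, c y * mFourier y x) • g x) volume :=
      hbdd _ (continuous_finsetSum s fun y _ => continuous_const.mul (mFourier y).continuous)
    have e : (fun x => (c a * mFourier a x + ∑ y ∈ s, c y * mFourier y x) • g x) =
        (c a • fun x => mFourier a x • g x) + fun x => (∑ y ∈ s, c y * mFourier y x) • g x := by
      funext x
      simp only [Pi.add_apply, Pi.smul_apply, add_smul, smul_smul]
    rw [e, FunctionSpaces.Torus.mFourierCoeff_add (h1.smul (c a)) h2, FunctionSpaces.Torus.mFourierCoeff_const_smul]
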